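import Summits.CriticalPhenomena.CardyFormulaZ2.Theorems.CardyComplexConeDefs
import Summits.CriticalPhenomena.CardyFormulaZ2.Theorems.ParafermionPrecompact.Negative.HeadPassage
import Literature.Barriers.CriticalPhenomena.FKParafermionicHalfCauchyRiemann
import Literature.Probability.LatticeModels.MedialWindingBridge

/-!
# The vertex–corner bridge `2cos(π/12) · F_E(z) = Σ_{corners c at z} cornerObs E c` (stub S1)

Helper file for the crux `CardySusyWard.ParafermionFamiliesToSLESix` (stmt-CriticalPhenomena-10814),
line `strip-anchored-vertex-normalisation`, stub `stub_vertexCornerBridge` (S1), in UNFOLDED form (tree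
vocabulary only; the skeleton's `vertexObs` / `G` are `rfl`-unfoldings of the two sides, so the skeleton
closes its stub by `fun E hE p hp δ hδ => vertexCornerBridge E hE p hp δ hδ`).

Proof.  Pathwise, `medialExploration E ω` is the cut orbit `explorationList β c₀ N`
(`medialExploration_eq_explorationList`).  A passage through `z` at position `k` has `0 < k < N`
(positions `0`, `N` are the two `A`–`B` edges); it arrives along the dart `orb (k-1)` (target `z`, winding
`A = Σ_{j<k-1} turnOf`) and leaves along `orb k` (source `z`, winding `A + t`, `t = ±π/2`); the vertex
weight is `exp(-i(A + t/2)/3)` (`windingAt_explorationList`), the two corner weights are `exp(-iA/3)`,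
`exp(-i(A+t)/3)`, and their sum is `2cos(t/6) exp(-i(A+t/2)/3)`, `cos(t/6) = cos(π/12)`.  Conversely a
dart is one of the four corners `medialCornersAt x i k` (barrier file `FKParafermionicHalfCauchyRiemann`)
iff its source or its target is `z` (explicit corner tables).  The two copies of the winding vocabulary
(`MedialPath.passageSum`, `Polyline.winding` in the statements; `windingAt`, `winding` in
`ExplorationWinding`) are bridged by `MedialWindingBridge`.  Integration: the corner integrands are
functionals of the exploration path, which only reads the finitely many edges of `Ω_δ`, hence integrable.
-/

noncomputable section

namespace Summit.CriticalPhenomena.CardyFormulaZ2.Theorems.ParafermionFamiliesToSLESix.StripAnchored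

open MeasureTheory Finset
open Literature.Probability.Percolation (bondPercolation half BondConfig)
open Literature.Probability.LatticeModels
open Literature.Probability.LatticeModels.DiscreteDobrushin (startCorner exitTime exitTime_pos
  isStartCorner_startCorner medialExploration_eq_explorationList isInnerFace_of_lt_exitTime
  not_isInnerFace_exitTime)
open Literature.Barriers.CriticalPhenomena (medialCornersAt medialVertexOf cornerEdge_medialCornersAt
  isCorner_medialCornersAt medialCornersAt_injective)
open Summit.CriticalPhenomena.CardyFormulaZ2.Cruxes.EdgePrecompact.QkzStripBoundaryArm (cornerObs)
open Summit.CriticalPhenomena.CardyFormulaZ2.Theorems.ParafermionPrecompact.Negative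
  (medialPath_passageSum_explorationList headEdge_mem_zdABEdges)

namespace S1

/-! ## Corner geometry at a medial vertex -/

/-- Source and target of a coded corner differ. [folklore] -/
theorem cSrc_ne_cTgt (r : Site 2 × Fin 4) : cSrc r ≠ cTgt r := fun h =>
  absurd (cornerUnit_injective (eq_of_sym2_add_eq h)) (by simp)

/-- A coded corner `r` with the vertex and face of `c = (v, f)` has `cornerSource v f = cSrc r`. [folklore] -/
theorem cornerSource_of_coded {r : Site 2 × Fin 4} {c : Site 2 × Site 2} (h1 : r.1 = c.1)
    (h2 : cFace r = c.2) : cornerSource c.1 c.2 = cSrc r := by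
  rw [← h1, ← h2]; exact cornerSource_cFace r

/-- Same for the target: `cornerTarget v f = cTgt r`. [folklore] -/
theorem cornerTarget_of_coded {r : Site 2 × Fin 4} {c : Site 2 × Site 2} (h1 : r.1 = c.1)
    (h2 : cFace r = c.2) : cornerTarget c.1 c.2 = cTgt r := by
  rw [← h1, ← h2]; exact cornerTarget_cFace r

/-- Each of the four corners at `s(x, x + eᵢ)` is a coded corner `(v, j)`. [folklore] -/
theorem exists_coded_medialCornersAt (x : Site 2) (i : Fin 2) (k : Fin 4) :
    ∃ r : Site 2 × Fin 4, r.1 = (medialCornersAt x i k).1 ∧ cFace r = (medialCornersAt x i k).2 := by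
  obtain ⟨j, hj⟩ := exists_faceAt_of_isCorner (isCorner_medialCornersAt x i k)
  exact ⟨((medialCornersAt x i k).1, j), rfl, hj.symm⟩

/-- One endpoint of each of the four corners at a medial vertex is that medial vertex. [folklore] -/
theorem cornerSource_eq_or_cornerTarget_eq (x : Site 2) (i : Fin 2) (k : Fin 4) :
    cornerSource (medialCornersAt x i k).1 (medialCornersAt x i k).2 = medialVertexOf (x, i) ∨
      cornerTarget (medialCornersAt x i k).1 (medialCornersAt x i k).2 = medialVertexOf (x, i) := by
  have he := cornerEdge_medialCornersAt x i k
  unfold cornerSource cornerTarget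
  fin_cases i
  · split_ifs
    · exact Or.inl he
    · exact Or.inr he
  · split_ifs
    · exact Or.inr he
    · exact Or.inl he

/-- Distinct corners at a medial vertex have distinct (source, target) pairs. [folklore] -/
theorem idx_eq_of_cornerSource_eq_of_cornerTarget_eq {x : Site 2} {i : Fin 2} {k k' : Fin 4}
    (hs : cornerSource (medialCornersAt x i k).1 (medialCornersAt x i k).2 =
      cornerSource (medialCornersAt x i k').1 (medialCornersAt x i k').2)
    (ht : cornerTarget (medialCornersAt x i k).1 (medialCornersAt x i k).2 =
      cornerTarget (medialCornersAt x i k').1 (medialCornersAt x i k').2) : k = k' := by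
  obtain ⟨r, hr1, hr2⟩ := exists_coded_medialCornersAt x i k
  obtain ⟨r', hr1', hr2'⟩ := exists_coded_medialCornersAt x i k'
  rw [cornerSource_of_coded hr1 hr2, cornerSource_of_coded hr1' hr2'] at hs
  rw [cornerTarget_of_coded hr1 hr2, cornerTarget_of_coded hr1' hr2'] at ht
  obtain rfl : r = r' := eq_of_cSrc_eq_of_cTgt_eq hs ht
  exact medialCornersAt_injective x i (Prod.ext (hr1.symm.trans hr1') (hr2.symm.trans hr2'))

/-- A coded corner with SOURCE `s(x, x + eᵢ)` is one of the four corners there. [folklore] -/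
theorem exists_idx_of_cSrc_eq {x : Site 2} {i : Fin 2} {r : Site 2 × Fin 4}
    (h : cSrc r = medialVertexOf (x, i)) :
    ∃ k : Fin 4, r.1 = (medialCornersAt x i k).1 ∧ cFace r = (medialCornersAt x i k).2 := by
  obtain ⟨v, j⟩ := r
  simp only [cSrc, medialVertexOf] at h
  rcases Sym2.eq_iff.1 h with ⟨rfl, h2⟩ | ⟨rfl, h2⟩
  · have hu : cornerUnit j = Pi.single i 1 := add_left_cancel h2
    fin_cases i <;> fin_cases j <;> (try exact absurd hu (by decide))
    · exact ⟨0, by simp [medialCornersAt], by simp [cFace, faceAt, cornerOff, medialCornersAt]⟩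
    · exact ⟨3, by simp [medialCornersAt], by simp [cFace, faceAt, cornerOff, medialCornersAt]⟩
  · have hu : cornerUnit j = -Pi.single i 1 := by
      have h3 : x + (Pi.single i 1 + cornerUnit j) = x + 0 := by rwa [← add_assoc, add_zero]
      exact eq_neg_of_add_eq_zero_right (add_left_cancel h3)
    fin_cases i <;> fin_cases j <;> (try exact absurd hu (by decide))
    · refine ⟨2, by simp [medialCornersAt], ?_⟩
      simp [cFace, faceAt, cornerOff, medialCornersAt]
      abel
    · exact ⟨1, by simp [medialCornersAt], by simp [cFace, faceAt, cornerOff, medialCornersAt]⟩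

/-- A coded corner with TARGET `s(x, x + eᵢ)` is one of the four corners there. [folklore] -/
theorem exists_idx_of_cTgt_eq {x : Site 2} {i : Fin 2} {r : Site 2 × Fin 4}
    (h : cTgt r = medialVertexOf (x, i)) :
    ∃ k : Fin 4, r.1 = (medialCornersAt x i k).1 ∧ cFace r = (medialCornersAt x i k).2 := by
  obtain ⟨v, j⟩ := r
  simp only [cTgt, medialVertexOf] at h
  rcases Sym2.eq_iff.1 h with ⟨rfl, h2⟩ | ⟨rfl, h2⟩
  · have hu : cornerUnit (j + 1) = Pi.single i 1 := add_left_cancel h2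
    fin_cases i <;> fin_cases j <;> (try exact absurd hu (by decide))
    · exact ⟨3, by simp [medialCornersAt], by simp [cFace, faceAt, cornerOff, medialCornersAt]⟩
    · exact ⟨2, by simp [medialCornersAt], by simp [cFace, faceAt, cornerOff, medialCornersAt]⟩
  · have hu : cornerUnit (j + 1) = -Pi.single i 1 := by
      have h3 : x + (Pi.single i 1 + cornerUnit (j + 1)) = x + 0 := by rwa [← add_assoc, add_zero]
      exact eq_neg_of_add_eq_zero_right (add_left_cancel h3)
    fin_cases i <;> fin_cases j <;> (try exact absurd hu (by decide))
    · exact ⟨1, by simp [medialCornersAt], by simp [cFace, faceAt, cornerOff, medialCornersAt]⟩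
    · exact ⟨0, by simp [medialCornersAt], by simp [cFace, faceAt, cornerOff, medialCornersAt]⟩

/-- **Which darts are corners at `z`.** For a coded corner `r` and a weight `c`, summing `c` over the
corners at `z = s(x, x + eᵢ)` with the (source, target) of `r` gives `c` once if the target of `r` is
`z`, plus `c` once if the source of `r` is `z` (never both). [folklore] -/
theorem sum_ite_corner_eq (x : Site 2) (i : Fin 2) (r : Site 2 × Fin 4) (c : ℂ) :
    (∑ k : Fin 4, if cSrc r = cornerSource (medialCornersAt x i k).1 (medialCornersAt x i k).2 ∧
        cTgt r = cornerTarget (medialCornersAt x i k).1 (medialCornersAt x i k).2 then c else 0) =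
      (if cTgt r = medialVertexOf (x, i) then c else 0) +
        (if cSrc r = medialVertexOf (x, i) then c else 0) := by
  have key : ∀ k : Fin 4, r.1 = (medialCornersAt x i k).1 → cFace r = (medialCornersAt x i k).2 →
      (∑ k' : Fin 4, if cSrc r = cornerSource (medialCornersAt x i k').1 (medialCornersAt x i k').2 ∧
        cTgt r = cornerTarget (medialCornersAt x i k').1 (medialCornersAt x i k').2 then c else 0) =
        c := by
    intro k h1 h2
    rw [Finset.sum_eq_single k]
    · rw [if_pos ⟨(cornerSource_of_coded h1 h2).symm, (cornerTarget_of_coded h1 h2).symm⟩]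
    · intro k' _ hne
      rw [if_neg]
      rintro ⟨hs, ht⟩
      refine hne (idx_eq_of_cornerSource_eq_of_cornerTarget_eq (x := x) (i := i) ?_ ?_)
      · rw [← hs, cornerSource_of_coded h1 h2]
      · rw [← ht, cornerTarget_of_coded h1 h2]
    · exact fun h => absurd (Finset.mem_univ k) h
  by_cases hs : cSrc r = medialVertexOf (x, i)
  · have ht : cTgt r ≠ medialVertexOf (x, i) := fun h => cSrc_ne_cTgt r (hs.trans h.symm)
    obtain ⟨k, h1, h2⟩ := exists_idx_of_cSrc_eq hs
    rw [if_neg ht, if_pos hs, zero_add, key k h1 h2]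
  · by_cases ht : cTgt r = medialVertexOf (x, i)
    · obtain ⟨k, h1, h2⟩ := exists_idx_of_cTgt_eq ht
      rw [if_pos ht, if_neg hs, add_zero, key k h1 h2]
    · rw [if_neg hs, if_neg ht, add_zero]
      refine Finset.sum_eq_zero fun k _ => ?_
      rw [if_neg]
      rintro ⟨hs', ht'⟩
      rcases cornerSource_eq_or_cornerTarget_eq x i k with h | h
      · exact hs (hs'.trans h)
      · exact ht (ht'.trans h)

/-! ## The two weights of a passage -/

/-- Every step of the exploration turns by `±π/2`. [folklore] -/
theorem turnOf_eq_or (β : BondConfig (Site 2)) (q : Site 2 × Fin 4) :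
    turnOf β q = Real.pi / 2 ∨ turnOf β q = -(Real.pi / 2) := by
  unfold turnOf; split_ifs <;> simp

/-- `2cos(π/12) · e^{-i(a + t/2)/3} = e^{-ia/3} + e^{-i(a+t)/3}` for `t = ±π/2`: the vertex weight (average
winding) against the two corner weights (arrival and departure windings). [folklore] -/
theorem two_cos_mul_exp_average (a t : ℝ) (ht : t = Real.pi / 2 ∨ t = -(Real.pi / 2)) :
    ((2 * Real.cos (Real.pi / 12) : ℝ) : ℂ) *
        Complex.exp (-Complex.I * ((1 / 3 : ℝ) : ℂ) * (((a + (a + t)) / 2 : ℝ) : ℂ)) =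
      Complex.exp (-(Complex.I / 3) * (a : ℂ)) + Complex.exp (-(Complex.I / 3) * ((a + t : ℝ) : ℂ)) := by
  have hc : Real.cos (Real.pi / 12) = Real.cos (t / 6) := by
    rcases ht with rfl | rfl
    · congr 1; ring
    · rw [← Real.cos_neg (Real.pi / 12)]; congr 1; ring
  rw [hc, Complex.ofReal_mul, Complex.ofReal_ofNat, Complex.ofReal_cos, Complex.two_cos, add_mul,
    ← Complex.exp_add, ← Complex.exp_add]
  congr 1 <;> (congr 1; push_cast; ring)

/-! ## Pathwise identity along the cut orbit -/

section Pathwise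

variable {β : BondConfig (Site 2)} {c₀ : Site 2 × Fin 4}

/-- Consecutive orbit corners chain (general configuration). [folklore] -/
theorem cSrc_cornerOrbit_succ' (β : BondConfig (Site 2)) (c₀ : Site 2 × Fin 4) (n : ℕ) :
    cSrc (cornerOrbit β c₀ (n + 1)) = cTgt (cornerOrbit β c₀ n) :=
  cSrc_nextCorner _

/-- **Corner side.** Along the cut orbit, the corner integrand of `cornerObs` at `(v, f)` is the sum, over
the positions `k < N` whose dart has the source and target of `(v, f)`, of `exp(-(i/3) Σ_{j<k} turnOf)`.
[folklore] -/
theorem cornerSum_explorationList {δ : ℝ} (hδ : δ ≠ 0) (N : ℕ) (v f : Site 2) :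
    (∑ k ∈ (Finset.range (explorationList β c₀ N).length).filter (fun k =>
        (explorationList β c₀ N)[k]? = some (cornerSource v f) ∧
          (explorationList β c₀ N)[k + 1]? = some (cornerTarget v f)),
        Complex.exp (-(Complex.I / 3) *
          ((Polyline.winding (((explorationList β c₀ N).map (medialPoint δ)).take (k + 2)) : ℝ) : ℂ))) =
      ∑ k ∈ Finset.range N, if cSrc (cornerOrbit β c₀ k) = cornerSource v f ∧
          cTgt (cornerOrbit β c₀ k) = cornerTarget v f then
        Complex.exp (-(Complex.I / 3) * ((∑ j ∈ Finset.range k, turnOf β (cornerOrbit β c₀ j) : ℝ) : ℂ))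
        else 0 := by
  rw [length_explorationList', Finset.sum_filter, Finset.sum_range_succ, if_neg, add_zero]
  · refine Finset.sum_congr rfl fun k hk => ?_
    rw [Finset.mem_range] at hk
    rw [map_medialPoint_explorationList, show k + 2 = (k + 1) + 1 from rfl,
      take_orbitPts δ c₀ (show k + 1 ≤ N by omega), Polyline.winding_eq_winding, winding_orbitPts hδ,
      Nat.add_sub_cancel]
    refine if_congr ?_ rfl rfl
    rw [List.getElem?_eq_getElem (by rw [length_explorationList']; omega),
      List.getElem?_eq_getElem (by rw [length_explorationList']; omega), getElem_explorationList',
      getElem_explorationList', cSrc_cornerOrbit_succ', Option.some.injEq, Option.some.injEq]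
  · exact fun h => absurd (List.getElem?_eq_some_iff.1 h.2).1 (by rw [length_explorationList']; omega)

/-- **Vertex side.** Along the cut orbit, if `z` is neither the first nor the last medial vertex,
`2cos(π/12) · passageSum` at `z` is the sum over the positions `k < N` of the corner weight
`exp(-(i/3) Σ_{j<k} turnOf)`, counted once if the dart `orb k` arrives at `z` and once if it leaves `z`.
[folklore] -/
theorem two_cos_mul_passageSum_explorationList {δ : ℝ} (hδ : δ ≠ 0) (N : ℕ) {z : MedialVertex}
    (h0 : cSrc (cornerOrbit β c₀ 0) ≠ z) (hN : cSrc (cornerOrbit β c₀ N) ≠ z) :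
    ((2 * Real.cos (Real.pi / 12) : ℝ) : ℂ) * MedialPath.passageSum (explorationList β c₀ N) δ (1 / 3) z =
      ∑ k ∈ Finset.range N,
        ((if cTgt (cornerOrbit β c₀ k) = z then
            Complex.exp (-(Complex.I / 3) * ((∑ j ∈ Finset.range k, turnOf β (cornerOrbit β c₀ j) : ℝ) : ℂ))
          else 0) +
         (if cSrc (cornerOrbit β c₀ k) = z then
            Complex.exp (-(Complex.I / 3) * ((∑ j ∈ Finset.range k, turnOf β (cornerOrbit β c₀ j) : ℝ) : ℂ))
          else 0)) := by
  rw [medialPath_passageSum_explorationList, Finset.mul_sum, Finset.sum_filter]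
  have key : ∀ k ∈ Finset.range (N + 1),
      (if cSrc (cornerOrbit β c₀ k) = z then ((2 * Real.cos (Real.pi / 12) : ℝ) : ℂ) *
        Complex.exp (-Complex.I * ((1 / 3 : ℝ) : ℂ) *
          ((MedialPath.windingAt (explorationList β c₀ N) δ k : ℝ) : ℂ)) else 0) =
      (if cSrc (cornerOrbit β c₀ k) = z then
          Complex.exp (-(Complex.I / 3) * ((∑ j ∈ Finset.range (k - 1), turnOf β (cornerOrbit β c₀ j) : ℝ) : ℂ))
        else 0) +
      (if cSrc (cornerOrbit β c₀ k) = z then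
          Complex.exp (-(Complex.I / 3) * ((∑ j ∈ Finset.range k, turnOf β (cornerOrbit β c₀ j) : ℝ) : ℂ))
        else 0) := by
    intro k hk
    split_ifs with hz
    · have h1 : k ≠ 0 := by rintro rfl; exact h0 hz
      have h2 : k ≠ N := by rintro rfl; exact hN hz
      rw [Finset.mem_range] at hk
      rw [MedialPath.windingAt_eq_windingAt, windingAt_explorationList hδ c₀ (show k < N by omega)]
      obtain ⟨j, rfl⟩ : ∃ j, k = j + 1 := ⟨k - 1, by omega⟩
      rw [Nat.add_sub_cancel, Finset.sum_range_succ]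
      exact two_cos_mul_exp_average _ _ (turnOf_eq_or β _)
    · rw [add_zero]
  rw [Finset.sum_congr rfl key, Finset.sum_add_distrib, Finset.sum_range_succ' _ N,
    Finset.sum_range_succ _ N, if_neg h0, if_neg hN, add_zero, add_zero, ← Finset.sum_add_distrib]
  refine Finset.sum_congr rfl fun k _ => ?_
  rw [cSrc_cornerOrbit_succ', Nat.add_sub_cancel]

/-- **The bridge, pathwise**, along the cut orbit `explorationList β c₀ N` through a medial vertex
`z = s(x, x + eᵢ)` other than its first and last:
`2cos(π/12) · passageSum γ δ (1/3) z = Σ_{k<4} (corner integrand of cornerObs at medialCornersAt x i k)`.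
[folklore] -/
theorem two_cos_mul_passageSum_eq_sum_corner {δ : ℝ} (hδ : δ ≠ 0) (N : ℕ) (p : Site 2 × Fin 2)
    (h0 : cSrc (cornerOrbit β c₀ 0) ≠ medialVertexOf p) (hN : cSrc (cornerOrbit β c₀ N) ≠ medialVertexOf p) :
    ((2 * Real.cos (Real.pi / 12) : ℝ) : ℂ) *
        MedialPath.passageSum (explorationList β c₀ N) δ (1 / 3) (medialVertexOf p) =
      ∑ k : Fin 4, ∑ n ∈ (Finset.range (explorationList β c₀ N).length).filter (fun n =>
          (explorationList β c₀ N)[n]? =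
              some (cornerSource (medialCornersAt p.1 p.2 k).1 (medialCornersAt p.1 p.2 k).2) ∧
            (explorationList β c₀ N)[n + 1]? =
              some (cornerTarget (medialCornersAt p.1 p.2 k).1 (medialCornersAt p.1 p.2 k).2)),
        Complex.exp (-(Complex.I / 3) *
          ((Polyline.winding (((explorationList β c₀ N).map (medialPoint δ)).take (n + 2)) : ℝ) : ℂ)) := by
  obtain ⟨x, i⟩ := p
  rw [two_cos_mul_passageSum_explorationList hδ N h0 hN]
  simp only [cornerSum_explorationList hδ]
  rw [Finset.sum_comm]
  exact Finset.sum_congr rfl fun n _ => (sum_ite_corner_eq x i (cornerOrbit β c₀ n) _).symm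

end Pathwise

/-! ## Integrability of functionals of the exploration path (admissible data) -/

/-- **Integrability.** For admissible data, every complex functional of the exploration path is
integrable against `P_{1/2}`: the path only reads the configuration on the finite edge set `S` of `Ω_δ`,
so the functional factors through the measurable restriction map into the finite space `Set S`.
[folklore] -/
theorem integrable_comp_medialExploration' {E : DiscreteDobrushin} (hE : E.IsZdAdmissible)
    (Φ : List MedialVertex → ℂ) :
    Integrable (fun ω : BondConfig (Site 2) => Φ (medialExploration E ω)) (bondPercolation (zdGraph 2) half) := by
  classical
  set S := (discreteDomainGraph E.Ω E.δ).edgeSet with hSdef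
  have hfin : S.Finite := by
    have hV : (meshDomain E.Ω E.δ).Finite := meshDomain_finite hE.isBounded hE.delta_pos
    refine ((hV.prod hV).image (fun q : Site 2 × Site 2 => s(q.1, q.2))).subset fun e he => ?_
    induction e using Sym2.ind with
    | _ a b =>
      have hab := discreteDomainGraph_adj_iff.1 ((SimpleGraph.mem_edgeSet _).1 he)
      exact ⟨(a, b), ⟨hab.2.1, hab.2.2⟩, rfl⟩
  haveI : Finite S := hfin.to_subtype
  have hcongr : ∀ ω : BondConfig (Site 2), medialExploration E (ω ∩ S) = medialExploration E ω := by
    intro ω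
    have hbc : E.bcBondConfig (ω ∩ S) = E.bcBondConfig ω := by
      ext e
      simp only [DiscreteDobrushin.mem_bcBondConfig_iff, Set.mem_inter_iff]
      exact ⟨fun ⟨he, h⟩ => ⟨he, h.imp id fun h' => ⟨h'.1.1, h'.2⟩⟩,
        fun ⟨he, h⟩ => ⟨he, h.imp id fun h' => ⟨⟨h'.1, he⟩, h'.2⟩⟩⟩
    have hP : IsMedialExploration E (ω ∩ S) = IsMedialExploration E ω := funext fun γ => propext
      ⟨fun hγ => { hγ with turn := hbc ▸ hγ.turn }, fun hγ => { hγ with turn := hbc.symm ▸ hγ.turn }⟩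
    unfold medialExploration
    exact congrArg (fun P : List MedialVertex → Prop =>
      if hp : ∃! γ, P γ then hp.exists.choose else ([] : List MedialVertex)) hP
  have hfac : (fun ω : BondConfig (Site 2) => Φ (medialExploration E ω)) =
      (fun c : Set S => Φ (medialExploration E (Subtype.val '' c))) ∘
        fun ω : BondConfig (Site 2) => {e : S | (e : Sym2 (Site 2)) ∈ ω} := by
    funext ω
    rw [Function.comp_apply, ← hcongr ω]
    congr 2
    ext e
    exact ⟨fun ⟨hω, heS⟩ => ⟨⟨e, heS⟩, hω, rfl⟩, fun ⟨e', he', h⟩ => h ▸ ⟨he', e'.2⟩⟩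
  have hmeas : Measurable fun ω : BondConfig (Site 2) => Φ (medialExploration E ω) := by
    rw [hfac]
    exact (measurable_of_finite _).comp (measurable_set_iff.2 fun _ => measurable_set_mem _)
  have hrange : (Set.range fun ω : BondConfig (Site 2) => Φ (medialExploration E ω)).Finite := by
    rw [hfac]; exact (Set.finite_range _).subset (Set.range_comp_subset_range _ _)
  obtain ⟨C, hC⟩ := (hrange.image fun b => ‖b‖).bddAbove
  exact Integrable.of_bound hmeas.aestronglyMeasurable C
    (Filter.Eventually.of_forall fun ω => hC ⟨_, ⟨ω, rfl⟩, rfl⟩)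

end S1

/-! ## The bridge -/

open S1 (two_cos_mul_passageSum_eq_sum_corner integrable_comp_medialExploration')

/-- **(S1) The vertex–corner bridge** (unfolded form of the skeleton's `VertexCornerBridge`): for
`ℤ²`-admissible Dobrushin data `E`, every medial vertex `z = s(x, x + eᵢ)` off the two `A`–`B` edges
and every reading mesh `δ > 0`,
`2cos(π/12) · ∫ passageSum (medialExploration E ω) δ (1/3) z dP_{1/2} = Σ_{k<4} cornerObs E δ (medialCornersAt x i k)`.
[folklore] -/
theorem vertexCornerBridge (E : DiscreteDobrushin) (hE : E.IsZdAdmissible) (p : Site 2 × Fin 2)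
    (hp : medialVertexOf p ∉ E.zdABEdges) (δ : ℝ) (hδ : 0 < δ) :
    ((2 * Real.cos (Real.pi / 12) : ℝ) : ℂ) *
        (∫ ω, Literature.Probability.LatticeModels.MedialPath.passageSum (medialExploration E ω) δ (1 / 3)
            (medialVertexOf p) ∂(bondPercolation (zdGraph 2) half)) =
      ∑ k : Fin 4, cornerObs E δ (medialCornersAt p.1 p.2 k).1 (medialCornersAt p.1 p.2 k).2 := by
  have h0 : ∀ ω, cSrc (cornerOrbit (E.bcBondConfig ω) (startCorner hE) 0) ≠ medialVertexOf p :=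
    fun ω h => hp (h ▸ headEdge_mem_zdABEdges hE)
  have hN : ∀ ω, cSrc (cornerOrbit (E.bcBondConfig ω) (startCorner hE) (exitTime hE ω)) ≠ medialVertexOf p := by
    intro ω h
    obtain ⟨M, hM⟩ : ∃ M, exitTime hE ω = M + 1 := ⟨exitTime hE ω - 1, by have := exitTime_pos hE ω; omega⟩
    rw [hM, cSrc_cornerOrbit_succ] at h
    refine hp (h ▸ cTgt_exit_mem_zdABEdges hE (isStartCorner_startCorner hE) ?_ ?_)
    · exact isInnerFace_of_lt_exitTime hE ω (by omega)
    · rw [← hM]; exact not_isInnerFace_exitTime hE ω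
  set Φ : Fin 4 → List MedialVertex → ℂ := fun k γ => ∑ n ∈ (Finset.range γ.length).filter (fun n =>
      γ[n]? = some (cornerSource (medialCornersAt p.1 p.2 k).1 (medialCornersAt p.1 p.2 k).2) ∧
        γ[n + 1]? = some (cornerTarget (medialCornersAt p.1 p.2 k).1 (medialCornersAt p.1 p.2 k).2)),
    Complex.exp (-(Complex.I / 3) * ((Polyline.winding ((γ.map (medialPoint δ)).take (n + 2)) : ℝ) : ℂ))
    with hΦ
  have hpt : ∀ ω, ((2 * Real.cos (Real.pi / 12) : ℝ) : ℂ) *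
      Literature.Probability.LatticeModels.MedialPath.passageSum (medialExploration E ω) δ (1 / 3)
        (medialVertexOf p) = ∑ k : Fin 4, Φ k (medialExploration E ω) := by
    intro ω
    rw [medialExploration_eq_explorationList hE ω]
    exact two_cos_mul_passageSum_eq_sum_corner hδ.ne' _ p (h0 ω) (hN ω)
  rw [← integral_const_mul, show (fun ω => ((2 * Real.cos (Real.pi / 12) : ℝ) : ℂ) *
      Literature.Probability.LatticeModels.MedialPath.passageSum (medialExploration E ω) δ (1 / 3)
        (medialVertexOf p)) = fun ω => ∑ k : Fin 4, Φ k (medialExploration E ω) from funext hpt,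
    integral_finsetSum _ fun k _ => integrable_comp_medialExploration' hE (Φ k)]
  -- buildfix 2026-08-20: `cornerObs` (CardyComplexConeDefs, rebuilt) reads `FermionicObservable`'s `winding`,
  -- `Φ` the `Polyline` copy: bridge (the lemma is `rfl` once the Literature dedupe makes them one constant).
  simp only [hΦ, cornerObs, Literature.Probability.LatticeModels.Polyline.winding_eq_winding']

/-- **(S1), registered one-line form** (sub-goal `stub_vertexCornerBridge_unfolded` of stmt-CriticalPhenomena-10814): the
skeleton's `VertexCornerBridge` with `vertexObs` / `G` unfolded, so that `stub_vertexCornerBridge : VertexCornerBridge` is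
`fun E hE p hp δ hδ => stub_vertexCornerBridge_unfolded E hE p hp δ hδ`. [folklore] -/
theorem stub_vertexCornerBridge_unfolded : ∀ (E : DiscreteDobrushin), E.IsZdAdmissible → ∀ p : Site 2 × Fin 2, medialVertexOf p ∉ E.zdABEdges → ∀ δ : ℝ, 0 < δ → ((2 * Real.cos (Real.pi / 12) : ℝ) : ℂ) * (∫ ω, Literature.Probability.LatticeModels.MedialPath.passageSum (medialExploration E ω) δ (1 / 3) (medialVertexOf p) ∂(bondPercolation (zdGraph 2) half)) = ∑ k : Fin 4, cornerObs E δ (medialCornersAt p.1 p.2 k).1 (medialCornersAt p.1 p.2 k).2 :=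
  vertexCornerBridge

end Summit.CriticalPhenomena.CardyFormulaZ2.Theorems.ParafermionFamiliesToSLESix.StripAnchored

end
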